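import Summits.QuantumFields.BalabanUV.T4Continuum.Support.NE3FrameFreeDecompositionW
import HarnessLib

/-!
# NE3FrameFreeDecompositionLinear (T⁴ programme, node NE3, route Π) — THE LINEAR STRUCTURE OF THE CURVED FRAME-FREE DECOMPOSITION
# `ker d(avg^k)_W ∩ {skew, periodic} = gaugeDir W (Ξ₀) ⊕ T_♮(W)`: the slice is closed under `0, +, −`; corner gauges add; the slice
# absorbs; BY UNIQUENESS the gauge component of a slice element vanishes, the gauge component is additive, and
# `gaugeDir W μ_{T₀+E} = gaugeDir W μ_E` for `T₀ ∈ T_♮(W)` (the Newton-step identity)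

NE3 (node U1b) formalisation swarm `b2b-balaban-t4-ne3-formalise-*`, leaf seat `b2b-balaban-t4-ne3-formalise-leaf-03` (gen 13); an
UNBOOKED generic helper over row K0b (`NE3FrameFreeDecompositionW`, leaf-02 gen 5: existence `exists_cornerGauge_mem_frameFreeBlockLandauW`
and uniqueness `frameFreeW_decomposition_unique` of the decomposition), INTENT journalled in `HOME/CLAIMS.log`.

WHY.  The owner's EXISTENCE campaign for the residual slice representative (design note D-ne3p1-g26-1 §1, Newton scheme on the residual
gauge group; stub (iii) «linearity of `Z ↦ mu(Z)` from uniqueness») uses exactly one algebraic fact about K0b's decomposition: writing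
`Z(u) = T(u) − gaugeDir W mu(u)` with `T(u) ∈ T_♮(W)`, the varied `Z(e^{μ}u) = T(u) + E′` has `mu(Z(e^{μ}u)) = mu(E′)` — in
direction form: THE CORNER GAUGE DIRECTION OF `T₀ + E` IS THAT OF `E` whenever `T₀ ∈ T_♮(W)`.  The alternative road (B8 Theorem 2
TYPE leaf, chart read «modulo `gaugeDir W (Ξ₀)`», note §6 (d)) projects modulo gauge directions with the same decomposition.  This file
proves that fact and the small linear kit around it, once, at every background of the multi-level small-field class.

CONTENT (all [folklore]; 0 sorry; 0 def; class = unitary `W` of period `tower L M (j+1)`, `0 ≤ x`, `LevelSmall d L j x`, `SmallField W x`):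
§1 `zero_mem_frameFreeBlockLandauW`, `add_mem_frameFreeBlockLandauW`, `neg_mem_frameFreeBlockLandauW`, `sub_mem_frameFreeBlockLandauW'`
   (closure of the Set `frameFreeBlockLandauW L M (j+1) W` — through the tower by `dirIter_add`, `framePotW_add`, `hsR_add_left`);
§2 `cornerGauge_add` (if `μ₁` moves `Y₁` and `μ₂` moves `Y₂` into the slice then `μ₁ + μ₂` moves `Y₁ + Y₂`), `cornerGauge_of_mem_add`
   (THE SLICE ABSORBS: a corner gauge of `E` is a corner gauge of `T₀ + E` for `T₀ ∈ T_♮(W)`);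
§3 by uniqueness: `gaugeDir_eq_zero_of_mem_slice` (a corner gauge moving a slice element into the slice has zero direction),
   `gaugeDir_cornerGauge_add` (ADDITIVITY of the gauge component), **`gaugeDir_cornerGauge_eq_of_mem_add`** (THE NEWTON-STEP IDENTITY),
   `slicePart_add` (additivity of the slice component).

HONEST FRAMING.  Exact linear algebra over landed K0a∕K0b at a fixed background; no estimate, no numeric line, nothing about Bałaban's
minimisers; the campaign's analytic letters (the slice projection's sup norms `P, P′`, the BCH letter, the right inverse's letters) are
NOT here; Π-L1♮, (Π-REG-γ″), (H∃) remain TYPED LEAVES; T-E_w♯ and NE3 are NOT proved; spine PROVED 0∕9; finite T⁴ rung (B)+1 — NOT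
infinite volume, NOT mass gap, NOT `BetaPertH`, NOT Clay.  ABSOLUTE RULE kept (no printed sentence is a hypothesis; context only:
[Balaban1985Variational] (83) p. 290, [Balaban1985RegularGauge] (1.27) p. 80).  PLACEMENT: `Summits/QuantumFields/BalabanUV/`.
HONEST DEPENDENCY: continuum YM on T⁴ ⇐ BetaPertH ∧ nine spine estimates (0/9 proved); BetaPertH ⇐ (D1) ∧ (D4) ∧ CAP+tail; G-an2-4
gates asym, D1 and NE2/3/4.
-/

set_option autoImplicit false

open scoped BigOperators Matrix.Norms.L2Operator
open Finset

namespace Summit.QuantumFields.BalabanUV.T4Continuum.NE3FrameFreeDecompositionLinear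

open Literature.MathematicalPhysics.QuantumFieldTheory.Balaban1983to89
open B7Prop1Explicit B7Prop2Explicit MatrixNorms
open T4AveragingDeficitWall (IsUnitaryCfg IsSkewDir SmallField)
open T4AveragingDeficitWallBoundary (IsPeriodicCfg periodBox)
open AveragingDeficitPeriodicCounting (IsPeriodicDir)
open AveragingDeficitMultiLevelPrep (TangentIter tower LevelSmall)
open BlockAveragePushDirGauge (gaugeDir isPeriodicDir_gaugeDir)
open NE3TangentCovariantStructure (gaugeDir_add_fun)
open NE3TangentCovariantTower (dirIter dirIter_add tangentIter_iff_dirIter_eq_zero framePotW)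
open NE3CovariantCalculus (hsR hsR_add_left)
open NE3LandauOrbit (gaugeDir_skew hsR_zero_left)
open NE3CurvedFrameKill (framePotW_add)
open NE3FrameFreeSliceW (cornerGaugeSpaceW frameFreeBlockLandauW)
open NE3FrameFreeDecompositionW (gaugeDir_sub_fun frameFreeW_decomposition_unique)

noncomputable section

variable {d : ℕ} {n : Type*} [Fintype n] [DecidableEq n] [Nonempty n]

/-! ## §1 The slice `T_♮(W)` is closed under `0`, `+`, `−` -/

/-- In the class, the linearised `(j+1)`-fold average of the zero direction vanishes (additivity with `A = B = 0`). [folklore] -/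
theorem dirIter_zero_dir {L : ℕ} (hL : 1 ≤ L) (j : ℕ) {W : Site d → Fin d → (Matrix n n ℂ)ˣ} {x : ℝ}
    (hWu : IsUnitaryCfg W) (hx : 0 ≤ x) (hs : LevelSmall d L j x) (hWx : SmallField W x) :
    dirIter L (j + 1) W (fun (_ : Site d) (_ : Fin d) => (0 : Matrix n n ℂ)) = fun _ _ => 0 := by
  have h := dirIter_add hL j hWu hx hs hWx (fun (_ : Site d) (_ : Fin d) => (0 : Matrix n n ℂ)) (fun _ _ => 0)
  have h0 : (fun (y : Site d) (μ : Fin d) => (fun (_ : Site d) (_ : Fin d) => (0 : Matrix n n ℂ)) y μ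
      + (fun (_ : Site d) (_ : Fin d) => (0 : Matrix n n ℂ)) y μ) = fun _ _ => 0 := by
    funext y μ; simp
  rw [h0] at h
  funext z κ
  have hz := congr_fun (congr_fun h z) κ
  -- `a = a + a` forces `a = 0`
  have : dirIter L (j + 1) W (fun (_ : Site d) (_ : Fin d) => (0 : Matrix n n ℂ)) z κ = 0 := by
    have h2 := hz
    simp only at h2
    exact left_eq_add.mp h2
  exact this

/-- In the class, the accumulated frame generator of the zero direction vanishes. [folklore] -/
theorem framePotW_zero_dir {L : ℕ} (hL : 1 ≤ L) (j : ℕ) {W : Site d → Fin d → (Matrix n n ℂ)ˣ} {x : ℝ}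
    (hWu : IsUnitaryCfg W) (hx : 0 ≤ x) (hs : LevelSmall d L j x) (hWx : SmallField W x) (z : Site d) :
    framePotW L (j + 1) W (fun (_ : Site d) (_ : Fin d) => (0 : Matrix n n ℂ)) z = 0 := by
  have h := framePotW_add hL j hWu hx hs hWx (fun (_ : Site d) (_ : Fin d) => (0 : Matrix n n ℂ)) (fun _ _ => 0) z
  have h0 : (fun (y : Site d) (ν : Fin d) => (fun (_ : Site d) (_ : Fin d) => (0 : Matrix n n ℂ)) y ν
      + (fun (_ : Site d) (_ : Fin d) => (0 : Matrix n n ℂ)) y ν) = fun _ _ => 0 := by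
    funext y μ; simp
  rw [h0] at h
  exact left_eq_add.mp h

/-- **`0 ∈ T_♮(W)`** at every background of the class. [folklore] -/
theorem zero_mem_frameFreeBlockLandauW {L M : ℕ} (hL : 1 ≤ L) (j : ℕ) {W : Site d → Fin d → (Matrix n n ℂ)ˣ} {x : ℝ}
    (hWu : IsUnitaryCfg W) (hx : 0 ≤ x) (hs : LevelSmall d L j x) (hWx : SmallField W x) :
    (fun (_ : Site d) (_ : Fin d) => (0 : Matrix n n ℂ)) ∈ frameFreeBlockLandauW (d := d) (n := n) L M (j + 1) W := by
  refine ⟨fun _ _ => (skewAdjoint _).zero_mem, fun _ _ _ => rfl, ?_, fun z => framePotW_zero_dir hL j hWu hx hs hWx z, fun μ _ => ?_⟩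
  · show TangentIter L (j + 1 - 1) W fun (_ : Site d) (_ : Fin d) => (0 : Matrix n n ℂ)
    rw [Nat.add_sub_cancel, tangentIter_iff_dirIter_eq_zero, dirIter_zero_dir hL j hWu hx hs hWx]
    rfl
  · exact Finset.sum_eq_zero fun y _ => Finset.sum_eq_zero fun κ _ => hsR_zero_left _

/-- **`T_♮(W)` IS CLOSED UNDER ADDITION** (every clause is linear: skewness, periodicity, tangency by `dirIter_add`, frame-freeness by
`framePotW_add`, orthogonality by `hsR_add_left`). [folklore] -/
theorem add_mem_frameFreeBlockLandauW {L M : ℕ} (hL : 1 ≤ L) (j : ℕ) {W : Site d → Fin d → (Matrix n n ℂ)ˣ} {x : ℝ}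
    (hWu : IsUnitaryCfg W) (hx : 0 ≤ x) (hs : LevelSmall d L j x) (hWx : SmallField W x)
    {X₁ X₂ : Site d → Fin d → Matrix n n ℂ} (h₁ : X₁ ∈ frameFreeBlockLandauW (d := d) (n := n) L M (j + 1) W)
    (h₂ : X₂ ∈ frameFreeBlockLandauW (d := d) (n := n) L M (j + 1) W) :
    (fun y ν => X₁ y ν + X₂ y ν) ∈ frameFreeBlockLandauW (d := d) (n := n) L M (j + 1) W := by
  obtain ⟨h₁s, h₁P, h₁T, h₁F, h₁o⟩ := h₁
  obtain ⟨h₂s, h₂P, h₂T, h₂F, h₂o⟩ := h₂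
  refine ⟨fun y ν => (skewAdjoint _).add_mem (h₁s y ν) (h₂s y ν), fun y i ν => ?_, ?_, fun z => ?_, fun μ hμ => ?_⟩
  · show X₁ _ ν + X₂ _ ν = X₁ y ν + X₂ y ν
    rw [h₁P y i ν, h₂P y i ν]
  · show TangentIter L (j + 1 - 1) W fun y ν => X₁ y ν + X₂ y ν
    rw [Nat.add_sub_cancel] at h₁T h₂T ⊢
    rw [tangentIter_iff_dirIter_eq_zero] at h₁T h₂T ⊢
    rw [dirIter_add hL j hWu hx hs hWx X₁ X₂, h₁T, h₂T]
    funext z κ; simp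
  · rw [framePotW_add hL j hWu hx hs hWx X₁ X₂ z, h₁F z, h₂F z, add_zero]
  · simp_rw [hsR_add_left, Finset.sum_add_distrib]
    rw [h₁o μ hμ, h₂o μ hμ, add_zero]

/-- **`T_♮(W)` IS CLOSED UNDER NEGATION.** [folklore] -/
theorem neg_mem_frameFreeBlockLandauW {L M : ℕ} (hL : 1 ≤ L) (j : ℕ) {W : Site d → Fin d → (Matrix n n ℂ)ˣ} {x : ℝ}
    (hWu : IsUnitaryCfg W) (hx : 0 ≤ x) (hs : LevelSmall d L j x) (hWx : SmallField W x)
    {X : Site d → Fin d → Matrix n n ℂ} (h : X ∈ frameFreeBlockLandauW (d := d) (n := n) L M (j + 1) W) :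
    (fun y ν => -X y ν) ∈ frameFreeBlockLandauW (d := d) (n := n) L M (j + 1) W := by
  obtain ⟨hXs, hXP, hXT, hXF, hXo⟩ := h
  -- the key identities `D(−X) = −D(X)` and `F(−X) = −F(X)` from additivity with `X + (−X) = 0`
  have hsum : (fun y ν => X y ν + (fun y ν => -X y ν) y ν) = fun (_ : Site d) (_ : Fin d) => (0 : Matrix n n ℂ) := by
    funext y ν; simp
  have hD : dirIter L (j + 1) W (fun y ν => -X y ν) = fun z κ => -dirIter L (j + 1) W X z κ := by
    have h := dirIter_add hL j hWu hx hs hWx X (fun y ν => -X y ν)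
    rw [hsum, dirIter_zero_dir hL j hWu hx hs hWx] at h
    funext z κ
    have hz : (0 : Matrix n n ℂ) = dirIter L (j + 1) W X z κ + dirIter L (j + 1) W (fun y ν => -X y ν) z κ :=
      congr_fun (congr_fun h z) κ
    exact (neg_eq_of_add_eq_zero_right hz.symm).symm
  have hFr : ∀ z, framePotW L (j + 1) W (fun y ν => -X y ν) z = -framePotW L (j + 1) W X z := by
    intro z
    have h := framePotW_add hL j hWu hx hs hWx X (fun y ν => -X y ν) z
    rw [hsum, framePotW_zero_dir hL j hWu hx hs hWx z] at h
    exact (neg_eq_of_add_eq_zero_right h.symm).symm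
  refine ⟨fun y ν => (skewAdjoint _).neg_mem (hXs y ν), fun y i ν => ?_, ?_, fun z => ?_, fun μ hμ => ?_⟩
  · show -X _ ν = -X y ν
    rw [hXP y i ν]
  · show TangentIter L (j + 1 - 1) W fun y ν => -X y ν
    rw [Nat.add_sub_cancel] at hXT ⊢
    rw [tangentIter_iff_dirIter_eq_zero] at hXT ⊢
    rw [hD, hXT]
    funext z κ; simp
  · rw [hFr z, hXF z, neg_zero]
  · have hneg : ∀ (y : Site d) (κ : Fin d), hsR (-X y κ) (gaugeDir W μ y κ) = -hsR (X y κ) (gaugeDir W μ y κ) := by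
      intro y κ
      have h := hsR_add_left (X y κ) (-X y κ) (gaugeDir W μ y κ)
      rw [add_neg_cancel, hsR_zero_left] at h
      linarith
    simp_rw [hneg, Finset.sum_neg_distrib]
    rw [hXo μ hμ, neg_zero]

/-- **`T_♮(W)` IS CLOSED UNDER SUBTRACTION** (general form; the tree's `NE3ResidualSliceRep.sub_mem_frameFreeBlockLandauW` is the special
constructor from two frame-free orthogonal fields with equal linearised average). [folklore] -/
theorem sub_mem_frameFreeBlockLandauW' {L M : ℕ} (hL : 1 ≤ L) (j : ℕ) {W : Site d → Fin d → (Matrix n n ℂ)ˣ} {x : ℝ}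
    (hWu : IsUnitaryCfg W) (hx : 0 ≤ x) (hs : LevelSmall d L j x) (hWx : SmallField W x)
    {X₁ X₂ : Site d → Fin d → Matrix n n ℂ} (h₁ : X₁ ∈ frameFreeBlockLandauW (d := d) (n := n) L M (j + 1) W)
    (h₂ : X₂ ∈ frameFreeBlockLandauW (d := d) (n := n) L M (j + 1) W) :
    (fun y ν => X₁ y ν - X₂ y ν) ∈ frameFreeBlockLandauW (d := d) (n := n) L M (j + 1) W := by
  have h := add_mem_frameFreeBlockLandauW hL j hWu hx hs hWx h₁ (neg_mem_frameFreeBlockLandauW hL j hWu hx hs hWx h₂)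
  have hfun : (fun y ν => X₁ y ν + (fun y ν => -X₂ y ν) y ν) = fun y ν => X₁ y ν - X₂ y ν := by
    funext y ν; simp [sub_eq_add_neg]
  rw [hfun] at h
  exact h

/-! ## §2 Corner gauges add; the slice absorbs -/

/-- **CORNER GAUGES ADD**: if `μ₁` moves `Y₁` and `μ₂` moves `Y₂` into `T_♮(W)`, then `μ₁ + μ₂` moves `Y₁ + Y₂` into `T_♮(W)`, and the
slice components add. [folklore] -/
theorem cornerGauge_add {L M : ℕ} (hL : 1 ≤ L) (j : ℕ) {W : Site d → Fin d → (Matrix n n ℂ)ˣ} {x : ℝ}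
    (hWu : IsUnitaryCfg W) (hx : 0 ≤ x) (hs : LevelSmall d L j x) (hWx : SmallField W x)
    {Y₁ Y₂ : Site d → Fin d → Matrix n n ℂ} {mu₁ mu₂ : Site d → Matrix n n ℂ}
    (hX₁ : (fun y ν => Y₁ y ν + gaugeDir W mu₁ y ν) ∈ frameFreeBlockLandauW (d := d) (n := n) L M (j + 1) W)
    (hX₂ : (fun y ν => Y₂ y ν + gaugeDir W mu₂ y ν) ∈ frameFreeBlockLandauW (d := d) (n := n) L M (j + 1) W) :
    (fun y ν => (Y₁ y ν + Y₂ y ν) + gaugeDir W (fun y => mu₁ y + mu₂ y) y ν) ∈ frameFreeBlockLandauW (d := d) (n := n) L M (j + 1) W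
      ∧ (fun y ν => (Y₁ y ν + Y₂ y ν) + gaugeDir W (fun y => mu₁ y + mu₂ y) y ν)
          = fun y ν => (Y₁ y ν + gaugeDir W mu₁ y ν) + (Y₂ y ν + gaugeDir W mu₂ y ν) := by
  have hfun : (fun y ν => (Y₁ y ν + Y₂ y ν) + gaugeDir W (fun y => mu₁ y + mu₂ y) y ν)
      = fun y ν => (Y₁ y ν + gaugeDir W mu₁ y ν) + (Y₂ y ν + gaugeDir W mu₂ y ν) := by
    funext y ν
    rw [gaugeDir_add_fun]
    abel
  refine ⟨?_, hfun⟩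
  rw [hfun]
  exact add_mem_frameFreeBlockLandauW hL j hWu hx hs hWx hX₁ hX₂

/-- **THE SLICE ABSORBS**: for `T₀ ∈ T_♮(W)`, a corner gauge `μ` moving `E` into `T_♮(W)` also moves `T₀ + E` into `T_♮(W)`. [folklore] -/
theorem cornerGauge_of_mem_add {L M : ℕ} (hL : 1 ≤ L) (j : ℕ) {W : Site d → Fin d → (Matrix n n ℂ)ˣ} {x : ℝ}
    (hWu : IsUnitaryCfg W) (hx : 0 ≤ x) (hs : LevelSmall d L j x) (hWx : SmallField W x)
    {T₀ E : Site d → Fin d → Matrix n n ℂ} {mu : Site d → Matrix n n ℂ}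
    (hT₀ : T₀ ∈ frameFreeBlockLandauW (d := d) (n := n) L M (j + 1) W)
    (hE : (fun y ν => E y ν + gaugeDir W mu y ν) ∈ frameFreeBlockLandauW (d := d) (n := n) L M (j + 1) W) :
    (fun y ν => (T₀ y ν + E y ν) + gaugeDir W mu y ν) ∈ frameFreeBlockLandauW (d := d) (n := n) L M (j + 1) W := by
  have h := add_mem_frameFreeBlockLandauW hL j hWu hx hs hWx hT₀ hE
  have hfun : (fun y ν => T₀ y ν + (fun y ν => E y ν + gaugeDir W mu y ν) y ν) = fun y ν => (T₀ y ν + E y ν) + gaugeDir W mu y ν := by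
    funext y ν; simp only [add_assoc]
  rw [hfun] at h
  exact h

/-! ## §3 Consequences of uniqueness: the gauge component vanishes on the slice, is additive, and ignores slice summands -/

omit [Nonempty n] in
/-- `gaugeDir W 0 = 0`. [folklore] -/
theorem gaugeDir_zero_fun (W : Site d → Fin d → (Matrix n n ℂ)ˣ) :
    gaugeDir W (fun (_ : Site d) => (0 : Matrix n n ℂ)) = fun _ _ => 0 := by
  funext y ν
  simp [gaugeDir, T4AveragingDeficitWall.Ad]

/-- **THE GAUGE COMPONENT OF A SLICE ELEMENT IS ZERO**: in the class (period `tower L M (j+1)`), if `Y ∈ T_♮(W)` and a skew periodic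
corner-trivial `μ` moves `Y` into `T_♮(W)`, then `gaugeDir W μ = 0` (uniqueness against the trivial gauge `0`). [folklore] -/
theorem gaugeDir_eq_zero_of_mem_slice {L M : ℕ} [NeZero M] (hL : 1 ≤ L) (j : ℕ)
    {W : Site d → Fin d → (Matrix n n ℂ)ˣ} {x : ℝ} (hWu : IsUnitaryCfg W)
    (hWP : IsPeriodicCfg W ((tower L M (j + 1) : ℕ) : ℤ)) (hx : 0 ≤ x) (hs : LevelSmall d L j x) (hWx : SmallField W x)
    {Y : Site d → Fin d → Matrix n n ℂ} (hY : Y ∈ frameFreeBlockLandauW (d := d) (n := n) L M (j + 1) W)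
    {mu : Site d → Matrix n n ℂ} (hmus : ∀ y, mu y ∈ skewAdjoint (Matrix n n ℂ))
    (hmuP : ∀ (y : Site d) (i : Fin d), mu (y + ((tower L M (j + 1) : ℕ) : ℤ) • e i) = mu y)
    (hmu0 : ∀ w : Site d, mu (((L : ℤ) ^ (j + 1)) • w) = 0)
    (hX : (fun y ν => Y y ν + gaugeDir W mu y ν) ∈ frameFreeBlockLandauW (d := d) (n := n) L M (j + 1) W) :
    gaugeDir W mu = 0 := by
  have h0 : (fun y ν => Y y ν + gaugeDir W (fun (_ : Site d) => (0 : Matrix n n ℂ)) y ν)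
      ∈ frameFreeBlockLandauW (d := d) (n := n) L M (j + 1) W := by
    have hfun : (fun y ν => Y y ν + gaugeDir W (fun (_ : Site d) => (0 : Matrix n n ℂ)) y ν) = Y := by
      funext y ν; rw [gaugeDir_zero_fun]; simp
    rw [hfun]; exact hY
  have hu := frameFreeW_decomposition_unique hL j hWu hWP hx hs hWx hmus (fun _ => (skewAdjoint _).zero_mem) hmuP
    (fun _ _ => rfl) hmu0 (fun _ => rfl) hX h0
  rw [hu, gaugeDir_zero_fun]
  rfl

/-- **THE NEWTON-STEP IDENTITY — THE GAUGE COMPONENT IGNORES SLICE SUMMANDS**: in the class, for `T₀ ∈ T_♮(W)`, if `μ_E` is a corner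
gauge of `E` and `μ_Y` a corner gauge of `T₀ + E` (both skew, `tower L M (j+1)`-periodic, corner-trivial, moving their field into
`T_♮(W)`), then `gaugeDir W μ_Y = gaugeDir W μ_E`.  Direction form of «`Z(e^{μ}u) = T(u) + E′ ⟹ mu(Z(e^{μ}u)) = mu(E′)`»
(D-ne3p1-g26-1 §1). [folklore] -/
theorem gaugeDir_cornerGauge_eq_of_mem_add {L M : ℕ} [NeZero M] (hL : 1 ≤ L) (j : ℕ)
    {W : Site d → Fin d → (Matrix n n ℂ)ˣ} {x : ℝ} (hWu : IsUnitaryCfg W)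
    (hWP : IsPeriodicCfg W ((tower L M (j + 1) : ℕ) : ℤ)) (hx : 0 ≤ x) (hs : LevelSmall d L j x) (hWx : SmallField W x)
    {T₀ E : Site d → Fin d → Matrix n n ℂ} (hT₀ : T₀ ∈ frameFreeBlockLandauW (d := d) (n := n) L M (j + 1) W)
    {muE muY : Site d → Matrix n n ℂ}
    (hEs : ∀ y, muE y ∈ skewAdjoint (Matrix n n ℂ)) (hYs : ∀ y, muY y ∈ skewAdjoint (Matrix n n ℂ))
    (hEP : ∀ (y : Site d) (i : Fin d), muE (y + ((tower L M (j + 1) : ℕ) : ℤ) • e i) = muE y)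
    (hYP : ∀ (y : Site d) (i : Fin d), muY (y + ((tower L M (j + 1) : ℕ) : ℤ) • e i) = muY y)
    (hE0 : ∀ w : Site d, muE (((L : ℤ) ^ (j + 1)) • w) = 0) (hY0 : ∀ w : Site d, muY (((L : ℤ) ^ (j + 1)) • w) = 0)
    (hE : (fun y ν => E y ν + gaugeDir W muE y ν) ∈ frameFreeBlockLandauW (d := d) (n := n) L M (j + 1) W)
    (hY : (fun y ν => (T₀ y ν + E y ν) + gaugeDir W muY y ν) ∈ frameFreeBlockLandauW (d := d) (n := n) L M (j + 1) W) :
    gaugeDir W muY = gaugeDir W muE :=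
  frameFreeW_decomposition_unique hL j hWu hWP hx hs hWx hYs hEs hYP hEP hY0 hE0 hY
    (cornerGauge_of_mem_add hL j hWu hx hs hWx hT₀ hE)

/-- **ADDITIVITY OF THE GAUGE COMPONENT**: in the class, if `μ₁`, `μ₂`, `μ` are corner gauges (skew, periodic, corner-trivial) of
`Y₁`, `Y₂`, `Y₁ + Y₂` respectively, then `gaugeDir W μ = gaugeDir W μ₁ + gaugeDir W μ₂`. [folklore] -/
theorem gaugeDir_cornerGauge_add {L M : ℕ} [NeZero M] (hL : 1 ≤ L) (j : ℕ)
    {W : Site d → Fin d → (Matrix n n ℂ)ˣ} {x : ℝ} (hWu : IsUnitaryCfg W)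
    (hWP : IsPeriodicCfg W ((tower L M (j + 1) : ℕ) : ℤ)) (hx : 0 ≤ x) (hs : LevelSmall d L j x) (hWx : SmallField W x)
    {Y₁ Y₂ : Site d → Fin d → Matrix n n ℂ} {mu₁ mu₂ mu : Site d → Matrix n n ℂ}
    (h₁s : ∀ y, mu₁ y ∈ skewAdjoint (Matrix n n ℂ)) (h₂s : ∀ y, mu₂ y ∈ skewAdjoint (Matrix n n ℂ))
    (hμs : ∀ y, mu y ∈ skewAdjoint (Matrix n n ℂ))
    (h₁P : ∀ (y : Site d) (i : Fin d), mu₁ (y + ((tower L M (j + 1) : ℕ) : ℤ) • e i) = mu₁ y)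
    (h₂P : ∀ (y : Site d) (i : Fin d), mu₂ (y + ((tower L M (j + 1) : ℕ) : ℤ) • e i) = mu₂ y)
    (hμP : ∀ (y : Site d) (i : Fin d), mu (y + ((tower L M (j + 1) : ℕ) : ℤ) • e i) = mu y)
    (h₁0 : ∀ w : Site d, mu₁ (((L : ℤ) ^ (j + 1)) • w) = 0) (h₂0 : ∀ w : Site d, mu₂ (((L : ℤ) ^ (j + 1)) • w) = 0)
    (hμ0 : ∀ w : Site d, mu (((L : ℤ) ^ (j + 1)) • w) = 0)
    (hX₁ : (fun y ν => Y₁ y ν + gaugeDir W mu₁ y ν) ∈ frameFreeBlockLandauW (d := d) (n := n) L M (j + 1) W)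
    (hX₂ : (fun y ν => Y₂ y ν + gaugeDir W mu₂ y ν) ∈ frameFreeBlockLandauW (d := d) (n := n) L M (j + 1) W)
    (hX : (fun y ν => (Y₁ y ν + Y₂ y ν) + gaugeDir W mu y ν) ∈ frameFreeBlockLandauW (d := d) (n := n) L M (j + 1) W) :
    gaugeDir W mu = fun y ν => gaugeDir W mu₁ y ν + gaugeDir W mu₂ y ν := by
  obtain ⟨h12, -⟩ := cornerGauge_add hL j hWu hx hs hWx hX₁ hX₂
  have hu := frameFreeW_decomposition_unique hL j hWu hWP hx hs hWx hμs (fun y => (skewAdjoint _).add_mem (h₁s y) (h₂s y)) hμP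
    (fun y i => by simp only [h₁P y i, h₂P y i]) hμ0 (fun w => by simp only [h₁0 w, h₂0 w, add_zero]) hX h12
  rw [hu]
  funext y ν
  exact gaugeDir_add_fun W mu₁ mu₂ y ν

/-- **ADDITIVITY OF THE SLICE COMPONENT**: with the same data, the slice components add:
`(Y₁+Y₂) + gaugeDir W μ = (Y₁ + gaugeDir W μ₁) + (Y₂ + gaugeDir W μ₂)`. [folklore] -/
theorem slicePart_add {L M : ℕ} [NeZero M] (hL : 1 ≤ L) (j : ℕ)
    {W : Site d → Fin d → (Matrix n n ℂ)ˣ} {x : ℝ} (hWu : IsUnitaryCfg W)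
    (hWP : IsPeriodicCfg W ((tower L M (j + 1) : ℕ) : ℤ)) (hx : 0 ≤ x) (hs : LevelSmall d L j x) (hWx : SmallField W x)
    {Y₁ Y₂ : Site d → Fin d → Matrix n n ℂ} {mu₁ mu₂ mu : Site d → Matrix n n ℂ}
    (h₁s : ∀ y, mu₁ y ∈ skewAdjoint (Matrix n n ℂ)) (h₂s : ∀ y, mu₂ y ∈ skewAdjoint (Matrix n n ℂ))
    (hμs : ∀ y, mu y ∈ skewAdjoint (Matrix n n ℂ))
    (h₁P : ∀ (y : Site d) (i : Fin d), mu₁ (y + ((tower L M (j + 1) : ℕ) : ℤ) • e i) = mu₁ y)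
    (h₂P : ∀ (y : Site d) (i : Fin d), mu₂ (y + ((tower L M (j + 1) : ℕ) : ℤ) • e i) = mu₂ y)
    (hμP : ∀ (y : Site d) (i : Fin d), mu (y + ((tower L M (j + 1) : ℕ) : ℤ) • e i) = mu y)
    (h₁0 : ∀ w : Site d, mu₁ (((L : ℤ) ^ (j + 1)) • w) = 0) (h₂0 : ∀ w : Site d, mu₂ (((L : ℤ) ^ (j + 1)) • w) = 0)
    (hμ0 : ∀ w : Site d, mu (((L : ℤ) ^ (j + 1)) • w) = 0)
    (hX₁ : (fun y ν => Y₁ y ν + gaugeDir W mu₁ y ν) ∈ frameFreeBlockLandauW (d := d) (n := n) L M (j + 1) W)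
    (hX₂ : (fun y ν => Y₂ y ν + gaugeDir W mu₂ y ν) ∈ frameFreeBlockLandauW (d := d) (n := n) L M (j + 1) W)
    (hX : (fun y ν => (Y₁ y ν + Y₂ y ν) + gaugeDir W mu y ν) ∈ frameFreeBlockLandauW (d := d) (n := n) L M (j + 1) W) :
    (fun y ν => (Y₁ y ν + Y₂ y ν) + gaugeDir W mu y ν)
      = fun y ν => (Y₁ y ν + gaugeDir W mu₁ y ν) + (Y₂ y ν + gaugeDir W mu₂ y ν) := by
  rw [gaugeDir_cornerGauge_add hL j hWu hWP hx hs hWx h₁s h₂s hμs h₁P h₂P hμP h₁0 h₂0 hμ0 hX₁ hX₂ hX]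
  funext y ν
  abel

end

end Summit.QuantumFields.BalabanUV.T4Continuum.NE3FrameFreeDecompositionLinear
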